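import Mathlib
import Literature.NumberTheory.Sieve.Maynard2016OmegaBound
import Literature.NumberTheory.Sieve.Maynard2016OmegaSmall
import HarnessLib

/-!
# Maynard 2016: positivity of the singular series `𝔖_{m,q}`

Topic `Literature/NumberTheory/Sieve`. J. Maynard, *Large gaps between primes*, Ann. of Math. (2)
183 (2016), 915–933 = arXiv:1408.5110, §5 display (5.2):
`𝔖_{m,q} = ∏_{p ≤ y} (1 − ω_{m,q}(p)/p)(1 − 1/p)^{−2k}`. For even `m`, `k ≥ 1` and `x` large in
terms of `k` (namely `2k ≤ w`, so that every prime `p ≤ 2k` divides `P_w`) every factor is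
positive: for `p ∣ P_w` one has `ω_{m,q}(p) ∈ {1, 2}` with `ω_{m,q}(2) = 1` (`m` even), and for
`p > 2k` one has `ω_{m,q}(p) ≤ 2k < p`. This positivity is what makes the normalisation
`𝔖_{m,q}^{-1}` of the measure `μ_{m,q}` in §5 and the division in (6.22) meaningful.

PROVED here (no named facts): `one_sub_omegaMQ_div_pos_of_dvd_Pw`, `singSeriesMQ_pos`
(pointwise, under `2k ≤ ⌊w⌋`), `eventually_two_mul_le_floor_wFun` and
`eventually_singSeriesMQ_pos : ∀ᶠ x, ∀ m even, ∀ q, 0 < 𝔖_{m,q}`.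

## References

* J. Maynard, *Large gaps between primes*, Ann. of Math. (2) 183 (2016), 915–933; arXiv:1408.5110,
  §5 (5.1)–(5.2). [Maynard2016LargeGaps]
-/

open Filter Finset
open scoped Topology

namespace Literature.NumberTheory.Sieve

namespace Maynard2016

/-- For `k ≥ 1`, `m` even and a prime `p ∣ P_w`: `0 < 1 − ω_{m,q}(p)/p`. [cite: Maynard2016LargeGaps, §5 display (5.2)] -/
theorem one_sub_omegaMQ_div_pos_of_dvd_Pw {k : ℕ} (hk : 0 < k) (x q : ℕ) {m p : ℕ}
    (hm : Even m) (hp : p.Prime) (hpw : p ∣ Pw x) :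
    0 < 1 - (omegaMQ k x m q p : ℝ) / p := by
  have hp0 : (0 : ℝ) < p := by exact_mod_cast hp.pos
  rw [sub_pos, div_lt_one hp0]
  rw [omegaMQ_eq_of_dvd_Pw hk x m q hp hpw]
  rcases hp.eq_two_or_odd' with rfl | hodd
  · rw [if_pos (even_iff_two_dvd.1 hm)]
    norm_num
  · -- `p` odd prime: `p ≥ 3 > 2 ≥ ω`
    have h3 : 3 ≤ p := by
      rcases hodd with ⟨t, ht⟩
      have := hp.two_le
      omega
    have h3' : (3 : ℝ) ≤ p := by exact_mod_cast h3
    split_ifs <;> push_cast <;> linarith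

/-- **`𝔖_{m,q} > 0`** for `k ≥ 1`, `m` even and `2k ≤ ⌊w⌋` (all `q`, all `ε`). [cite: Maynard2016LargeGaps, §5 display (5.2)] -/
theorem singSeriesMQ_pos {k : ℕ} (hk : 0 < k) (ε : ℝ) {x m : ℕ} (q : ℕ) (hm : Even m)
    (hw : 2 * k ≤ ⌊wFun x⌋₊) : 0 < singSeriesMQ k ε x m q := by
  unfold singSeriesMQ
  refine Finset.prod_pos fun p hp => ?_
  rw [Finset.mem_filter] at hp
  have hpr : p.Prime := hp.2
  have hp0 : (0 : ℝ) < p := by exact_mod_cast hpr.pos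
  have hfac2 : 0 < ((1 - 1 / (p : ℝ)) ^ (2 * k))⁻¹ := by
    apply inv_pos.2 (pow_pos _ _)
    rw [sub_pos, div_lt_one hp0]
    exact_mod_cast hpr.one_lt
  refine mul_pos ?_ hfac2
  rcases le_or_gt p (2 * k) with hle | hlt
  · -- `p ≤ 2k ≤ ⌊w⌋`, so `p ∣ P_w`
    have hpw : p ∣ Pw x := by
      unfold Pw
      exact hpr.dvd_primorial_iff.2 (hle.trans hw)
    exact one_sub_omegaMQ_div_pos_of_dvd_Pw hk x q hm hpr hpw
  · exact one_sub_omegaMQ_div_pos k x m q hpr hlt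

/-- `2k ≤ ⌊w⌋` for all large `x` ("`x` sufficiently large in terms of `k`"). [cite: Maynard2016LargeGaps, §4 (choice of w)] -/
theorem eventually_two_mul_le_floor_wFun (k : ℕ) : ∀ᶠ x : ℕ in atTop, 2 * k ≤ ⌊wFun x⌋₊ := by
  filter_upwards [eventually_le_wFun ((2 * k : ℕ) : ℝ)] with x hx
  exact Nat.le_floor hx

/-- **Eventually `𝔖_{m,q} > 0`** for every even `m` and every `q` (`k ≥ 1`, any `ε`). [cite: Maynard2016LargeGaps, §5 display (5.2)] -/
theorem eventually_singSeriesMQ_pos {k : ℕ} (hk : 0 < k) (ε : ℝ) :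
    ∀ᶠ x : ℕ in atTop, ∀ m : ℕ, Even m → ∀ q : ℕ, 0 < singSeriesMQ k ε x m q := by
  filter_upwards [eventually_two_mul_le_floor_wFun k] with x hx m hm q
  exact singSeriesMQ_pos hk ε q hm hx

end Maynard2016

end Literature.NumberTheory.Sieve
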